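import Mathlib.Probability.BrownianMotion.Basic
import Literature.Probability.RandomPlanarGeometry.LoewnerInverse
import HarnessLib

/-!
# Rohde–Schramm's derivative estimate (Cor. 3.5) and the exponents of §3

Trunk T-STOCH. After `SLETraceCriterionProofs` (which proves Rohde–Schramm's deterministic
criterion Thm. 4.1), the Rohde–Schramm trace theorem `Literature.Probability.RandomPlanarGeometry.hasSLETrace_of_ne_eight`
(`SLE.lean`; *Basic properties of SLE*, Ann. Math. 161 (2005), Thm. 5.1) rests on the single
named fact `Literature.Probability.RandomPlanarGeometry.RohdeSchramm2005_thm36` (`SLETraceCriterion.lean`; Thm. 3.6, p. 895): for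
`κ > 0`, `κ ≠ 8`, almost surely `H(y, t) := f̂ₜ(iy)` extends continuously to `[0, ∞) × [0, ∞)`.
The printed proof of Thm. 3.6 (pp. 895–898) has exactly one stochastic-calculus input, the
one-point derivative estimate **Cor. 3.5** (p. 894; from Thm. 3.2, an Itô computation for the
time-changed backward flow, Lemma 3.1, `f̂ₜ - ξ(t)` has the law of `g₋ₜ`, and the Schwarz lemma);
everything else (Borel–Cantelli over the dyadic grid, Koebe distortion, the modulus of
continuity of `ξ`, the chaining of p. 897–898, scale invariance; cf. Lawler, *Conformally
Invariant Processes in the Plane* (2005), Lemma 4.33 and the proof of Thm. 7.4 for the same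
architecture) is deterministic or elementary probability. This file vendors Cor. 3.5,
faithfully to its printed scope, as the named fact `Literature.Probability.RandomPlanarGeometry.RohdeSchramm2005_cor35`, together with
the vocabulary it is stated in:

* `Literature.RohdeSchramm.expA κ b`, `Literature.RohdeSchramm.expLam κ b` — the exponents `a`, `λ` of (3.6)
  with `ν = 1`; `Literature.RohdeSchramm.theta δ s` — the correction factor `ϑ(δ, s)` of Cor. 3.5;
  `Literature.RohdeSchramm.bStar κ = (8 + κ)/(4κ)` and `Literature.RohdeSchramm.sigma0 κ = (λ - 2)/max{a, λ}` —
  the choices made on p. 895 in the proof of Thm. 3.6, with the computation behind "Note that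
  `λ > 2`" (`expLam_bStar_sub_two`: `λ - 2 = (κ - 8)²/(16κ)`, the only place where `κ ≠ 8`
  enters) and `0 < σ₀ < 1` (`sigma0_pos`, `sigma0_lt_one`);
* `Literature.Loewner.fHat W t z = fₜ(z + W t)` — Rohde–Schramm's `f̂ₜ` (p. 887), with
  `fₜ = gₜ⁻¹ = Literature.Loewner.loewnerInv W t` (`LoewnerInverse.lean`); it is holomorphic on `ℍₒ`
  (`differentiableAt_fHat`), so that `f̂ₜ'` is `deriv (fHat W t)`;
* `Literature.Loewner.tipApproach W (y, t) = f̂ₜ(iy)` — Rohde–Schramm's `H(y, t)` (Thm. 3.6) on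
  `ℝ≥0 × ℝ≥0`, junk at `y = 0` (that the junk can be replaced by a continuous extension is the
  content of Thm. 3.6; `RohdeSchramm2005_thm36` is literally this statement for
  `W = sleDriving κ ω`, see `tipApproach_apply`).

The fact is stated for an arbitrary Brownian motion `B` with everywhere-continuous paths on an
arbitrary probability space (Mathlib `ProbabilityTheory.IsBrownianReal`) and the driving function
`ξ = √κ B` (Rohde–Schramm write `ξ(t) = B(κt)` in §3 and `√κ Bₜ` in §2.1; the two classes of
processes coincide, `B(κ·) = √κ · (B(κ·)/√κ)` with `B(κ·)/√κ` again a Brownian motion), so that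
the scale invariance of SLE (Prop. 2.1 (i)), by which the printed proof of Thm. 3.6 reduces to
`t ∈ [0, 1]`, is available to consumers through Mathlib's `IsBrownianReal.smul`.

## References

* S. Rohde, O. Schramm, *Basic properties of SLE*, Ann. of Math. 161 (2005) 883–924: §2.1
  (p. 886–887), (3.6) and Thm. 3.2 (p. 890), Lemma 3.1 (p. 889), Cor. 3.5 (p. 894), Thm. 3.6 and
  its proof (pp. 895–898).
* G. F. Lawler, *Conformally Invariant Processes in the Plane*, AMS (2005), Cor. 7.3, Lemma 4.33,
  Thm. 7.4.
-/

noncomputable section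

open Set Filter Topology Metric Complex MeasureTheory ProbabilityTheory
open UpperHalfPlane (upperHalfPlaneSet isOpen_upperHalfPlaneSet)
open scoped NNReal ENNReal

namespace Literature.Probability.RandomPlanarGeometry

/-! ### The exponents of Rohde–Schramm §3 -/

namespace RohdeSchramm

/-- The exponent `a = a(κ, b) := 2b + κ b (1 - b)/2` of Rohde–Schramm (2005), eq. (3.6), with
`ν = 1`. [cite: RohdeSchramm2005, eq. (3.6)] -/
def expA (κ b : ℝ) : ℝ := 2 * b + κ * b * (1 - b) / 2

/-- The exponent `λ = λ(κ, b) := 4b + κ b (1 - 2b)/2` of Rohde–Schramm (2005), eq. (3.6), with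
`ν = 1`. [cite: RohdeSchramm2005, eq. (3.6)] -/
def expLam (κ b : ℝ) : ℝ := 4 * b + κ * b * (1 - 2 * b) / 2

/-- The choice `b = (8 + κ)/(4κ)` of the proof of Thm. 3.6 (p. 895: "Take `b = (8 + κ)/4κ`"),
which maximises `λ(κ, ·)`. [cite: RohdeSchramm2005, Thm 3.6 (proof, p. 895)] -/
def bStar (κ : ℝ) : ℝ := (8 + κ) / (4 * κ)

/-- The exponent bound `σ₀ := (λ - 2)/max{a, λ}` of the proof of Thm. 3.6 (p. 895), with
`a, λ` given by (3.6) (`ν = 1`) at `b = (8 + κ)/(4κ)`. [cite: RohdeSchramm2005, Thm 3.6 (proof, p. 895)] -/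
def sigma0 (κ : ℝ) : ℝ :=
  (expLam κ (bStar κ) - 2) / max (expA κ (bStar κ)) (expLam κ (bStar κ))

/-- The correction factor `ϑ(δ, s)` of Rohde–Schramm (2005), Cor. 3.5: `δ^{-s}` for `s > 0`,
`1 + |log δ|` for `s = 0`, and `1` for `s < 0`. [cite: RohdeSchramm2005, Cor 3.5] -/
def theta (δ s : ℝ) : ℝ :=
  if 0 < s then δ ^ (-s) else if s = 0 then 1 + |Real.log δ| else 1

/-- Unfolding lemma for `expA`. [folklore] -/
theorem expA_apply (κ b : ℝ) : expA κ b = 2 * b + κ * b * (1 - b) / 2 := rfl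

/-- Unfolding lemma for `expLam`. [folklore] -/
theorem expLam_apply (κ b : ℝ) : expLam κ b = 4 * b + κ * b * (1 - 2 * b) / 2 := rfl

/-- `ϑ(δ, s) = δ^{-s}` for `s > 0`. [folklore] -/
theorem theta_of_pos (δ : ℝ) {s : ℝ} (hs : 0 < s) : theta δ s = δ ^ (-s) := by
  simp [theta, hs]

/-- `ϑ(δ, 0) = 1 + |log δ|`. [folklore] -/
theorem theta_zero (δ : ℝ) : theta δ 0 = 1 + |Real.log δ| := by
  simp [theta]

/-- `ϑ(δ, s) = 1` for `s < 0`. [folklore] -/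
theorem theta_of_neg (δ : ℝ) {s : ℝ} (hs : s < 0) : theta δ s = 1 := by
  simp [theta, not_lt.2 hs.le, hs.ne]

/-- `ϑ ≥ 1` on `δ ∈ (0, 1]`. [folklore] -/
theorem one_le_theta {δ : ℝ} (hδ0 : 0 < δ) (hδ1 : δ ≤ 1) (s : ℝ) : 1 ≤ theta δ s := by
  rcases lt_trichotomy 0 s with hs | rfl | hs
  · rw [theta_of_pos δ hs]
    exact Real.one_le_rpow_of_pos_of_le_one_of_nonpos hδ0 hδ1 (by linarith)
  · rw [theta_zero]
    linarith [abs_nonneg (Real.log δ)]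
  · rw [theta_of_neg δ hs]

/-- `ϑ(δ, s) ≤ δ^{-s} (1 + |log δ|)`-type domination is not needed; what consumers use is the
power bound `ϑ(δ, s) ≤ δ^{-max{s, 0}} (1 + |log δ|)` for `δ ∈ (0, 1]`. [folklore] -/
theorem theta_le {δ : ℝ} (hδ0 : 0 < δ) (hδ1 : δ ≤ 1) (s : ℝ) :
    theta δ s ≤ δ ^ (-max s 0) * (1 + |Real.log δ|) := by
  have hlog : 1 ≤ 1 + |Real.log δ| := by linarith [abs_nonneg (Real.log δ)]
  have hpow : 1 ≤ δ ^ (-max s 0) :=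
    Real.one_le_rpow_of_pos_of_le_one_of_nonpos hδ0 hδ1 (by simp)
  rcases lt_trichotomy 0 s with hs | rfl | hs
  · rw [theta_of_pos δ hs, max_eq_left hs.le]
    exact le_mul_of_one_le_right (by positivity) hlog
  · rw [theta_zero, max_self, neg_zero, Real.rpow_zero, one_mul]
  · rw [theta_of_neg δ hs]
    exact one_le_mul_of_one_le_of_one_le hpow hlog

/-- At `b = (8 + κ)/(4κ)`: `λ = (κ + 8)²/(16κ)`. [cite: RohdeSchramm2005, Thm 3.6 (proof, p. 895)] -/
theorem expLam_bStar {κ : ℝ} (hκ : κ ≠ 0) : expLam κ (bStar κ) = (κ + 8) ^ 2 / (16 * κ) := by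
  rw [expLam, bStar]
  field_simp
  ring

/-- At `b = (8 + κ)/(4κ)`: `λ - 2 = (κ - 8)²/(16κ)`, so that `λ > 2` iff `κ ≠ 8` (p. 895: "Note
that `λ > 2`"). [cite: RohdeSchramm2005, Thm 3.6 (proof, p. 895)] -/
theorem expLam_bStar_sub_two {κ : ℝ} (hκ : κ ≠ 0) :
    expLam κ (bStar κ) - 2 = (κ - 8) ^ 2 / (16 * κ) := by
  rw [expLam_bStar hκ]
  field_simp
  ring

/-- At `b = (8 + κ)/(4κ)`: `a = 2/κ + 1 + 3κ/32`. [cite: RohdeSchramm2005, Thm 3.6 (proof, p. 895)] -/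
theorem expA_bStar {κ : ℝ} (hκ : κ ≠ 0) : expA κ (bStar κ) = 2 / κ + 1 + 3 * κ / 32 := by
  rw [expA, bStar]
  field_simp
  ring

/-- For `κ > 0`, `κ ≠ 8`: `λ(κ, b⋆) > 2`. [cite: RohdeSchramm2005, Thm 3.6 (proof, p. 895)] -/
theorem two_lt_expLam_bStar {κ : ℝ} (hκ : 0 < κ) (h8 : κ ≠ 8) : 2 < expLam κ (bStar κ) := by
  have h := expLam_bStar_sub_two hκ.ne'
  have hpos : 0 < (κ - 8) ^ 2 / (16 * κ) := by
    have : (κ - 8) ^ 2 ≠ 0 := pow_ne_zero 2 (sub_ne_zero.2 h8)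
    positivity
  linarith

/-- At `κ = 8`: `λ(8, b⋆) = 2` exactly (the borderline case excluded in Thm. 3.6). [folklore] -/
theorem expLam_bStar_eight : expLam 8 (bStar 8) = 2 := by
  rw [expLam_bStar (by norm_num)]
  norm_num

/-- For `κ > 0`: `a(κ, b⋆) > 0`. [folklore] -/
theorem expA_bStar_pos {κ : ℝ} (hκ : 0 < κ) : 0 < expA κ (bStar κ) := by
  rw [expA_bStar hκ.ne']
  positivity

/-- For `κ > 0`, `κ ≠ 8`: `σ₀ > 0`. [cite: RohdeSchramm2005, Thm 3.6 (proof, p. 895)] -/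
theorem sigma0_pos {κ : ℝ} (hκ : 0 < κ) (h8 : κ ≠ 8) : 0 < sigma0 κ := by
  have h2 := two_lt_expLam_bStar hκ h8
  exact div_pos (by linarith) (lt_max_of_lt_right (by linarith))

/-- For `κ > 0`: `σ₀ < 1` (as `λ - 2 < λ ≤ max{a, λ}`). [folklore] -/
theorem sigma0_lt_one {κ : ℝ} (hκ : 0 < κ) : sigma0 κ < 1 := by
  have ha := expA_bStar_pos hκ
  have hm : 0 < max (expA κ (bStar κ)) (expLam κ (bStar κ)) := lt_max_of_lt_left ha
  rw [sigma0, div_lt_one hm]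
  linarith [le_max_right (expA κ (bStar κ)) (expLam κ (bStar κ))]

/-- The defining inequality of `σ₀`, in the form used in the proof of Thm. 3.6: for
`0 < σ < σ₀` the exponent `(1 - σ) λ - σ max{a - λ, 0}` exceeds `2`. [cite: RohdeSchramm2005, Thm 3.6 (proof, p. 895)] -/
theorem two_lt_of_lt_sigma0 {κ σ : ℝ} (hκ : 0 < κ) (hσ : σ < sigma0 κ) :
    2 < (1 - σ) * expLam κ (bStar κ) - σ * max (expA κ (bStar κ) - expLam κ (bStar κ)) 0 := by
  set A := expA κ (bStar κ) with hA
  set L := expLam κ (bStar κ) with hL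
  have hm : 0 < max A L := lt_max_of_lt_left (expA_bStar_pos hκ)
  have h1 : σ * max A L < L - 2 := by
    have := (lt_div_iff₀ hm).1 hσ
    linarith
  have hmax : max (A - L) 0 = max A L - L := by
    rcases le_total A L with h | h
    · rw [max_eq_right (sub_nonpos.2 h), max_eq_right h, sub_self]
    · rw [max_eq_left (sub_nonneg.2 h), max_eq_left h]
  rw [hmax]
  have hring : (1 - σ) * L - σ * (max A L - L) = L - σ * max A L := by ring
  rw [hring]
  linarith

/-- The choice `b⋆ = (8 + κ)/(4κ)` is admissible in Cor. 3.5: `0 ≤ b⋆ ≤ 1 + 4/κ` for `κ > 0`.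
[folklore] -/
theorem bStar_mem_Icc {κ : ℝ} (hκ : 0 < κ) : bStar κ ∈ Icc 0 (1 + 4 / κ) := by
  constructor
  · rw [bStar]; positivity
  · rw [bStar, div_le_iff₀ (by positivity)]
    have h : (1 + 4 / κ) * (4 * κ) = 4 * κ + 16 := by
      field_simp
      ring
    rw [h]
    linarith

end RohdeSchramm

/-! ### `f̂ₜ` and `H(y, t)` -/

namespace Loewner

variable {W : ℝ≥0 → ℝ}

/-- Rohde–Schramm's **`f̂ₜ(z) := fₜ(z + ξ(t))`** (p. 887), with `fₜ = gₜ⁻¹ = loewnerInv W t` the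
inverse Loewner map of the driving function `W = ξ`; junk off `ℍₒ` (inherited from
`Function.invFunOn`). [cite: RohdeSchramm2005, §2.1 (p. 887)] -/
def fHat (W : ℝ≥0 → ℝ) (t : ℝ≥0) (z : ℂ) : ℂ :=
  loewnerInv W t ((W t : ℂ) + z)

/-- Unfolding lemma for `fHat`. [folklore] -/
theorem fHat_apply (W : ℝ≥0 → ℝ) (t : ℝ≥0) (z : ℂ) : fHat W t z = loewnerInv W t ((W t : ℂ) + z) :=
  rfl

/-- `f̂ₜ` as a composition with the translation by `W t`. [folklore] -/
theorem fHat_eq_comp (W : ℝ≥0 → ℝ) (t : ℝ≥0) : fHat W t = loewnerInv W t ∘ fun z ↦ (W t : ℂ) + z :=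
  rfl

/-- `f̂ₜ` maps `ℍₒ` into `Hₜ` (continuous driving function). [folklore] -/
theorem fHat_mem_domain (hW : Continuous W) (t : ℝ≥0) {z : ℂ} (hz : 0 < z.im) :
    fHat W t z ∈ domain W t :=
  loewnerInv_mem_domain hW t (by simpa using hz)

/-- `gₜ (f̂ₜ z) = z + W t` on `ℍₒ`. [folklore] -/
theorem map_fHat (hW : Continuous W) (t : ℝ≥0) {z : ℂ} (hz : 0 < z.im) :
    map W t (fHat W t z) = (W t : ℂ) + z :=
  map_loewnerInv hW t (by simpa using hz)

/-- `f̂ₜ` takes values in `ℍₒ` on `ℍₒ`. [folklore] -/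
theorem im_fHat_pos (hW : Continuous W) (t : ℝ≥0) {z : ℂ} (hz : 0 < z.im) : 0 < (fHat W t z).im :=
  im_loewnerInv_pos hW t (by simpa using hz)

/-- At time `0`, `f̂₀ z = z + W 0` on `ℍₒ` (`g₀ = id`). [folklore] -/
theorem fHat_zero (hW : Continuous W) {z : ℂ} (hz : 0 < z.im) : fHat W 0 z = (W 0 : ℂ) + z := by
  have hw : 0 < ((W 0 : ℂ) + z).im := by simpa using hz
  have hdom : (W 0 : ℂ) + z ∈ domain W 0 := by
    rw [mem_domain_iff]
    refine ⟨hw, ?_⟩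
    rw [WithTop.coe_zero]
    exact swallowingTime_pos_holds hW (ne_driving_of_im_pos hw 0)
  have h1 : map W 0 ((W 0 : ℂ) + z) = (W 0 : ℂ) + z :=
    map_zero_apply hW (ne_driving_of_im_pos hw 0)
  have h2 := loewnerInv_map hW hdom
  rw [h1] at h2
  rw [fHat_apply]
  exact h2

/-- **`f̂ₜ` is holomorphic on `ℍₒ` with non-vanishing derivative** (from the same statement for
`fₜ`, `LoewnerFlow.hasDerivAt_invFunOn_map`). [cite: Lawler2005, Ch. 4 §4.1] -/
theorem hasDerivAt_fHat (hW : Continuous W) (t : ℝ≥0) {z : ℂ} (hz : 0 < z.im) :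
    ∃ f' : ℂ, f' ≠ 0 ∧ HasDerivAt (fHat W t) f' z := by
  have hw : 0 < ((W t : ℂ) + z).im := by simpa using hz
  obtain ⟨f', hf', hd⟩ := hasDerivAt_invFunOn_map hW t hw
  refine ⟨f', hf', ?_⟩
  have htr : HasDerivAt (fun w : ℂ ↦ (W t : ℂ) + w) 1 z := (hasDerivAt_id z).const_add _
  have := hd.comp z htr
  simpa [fHat_eq_comp] using this

/-- `f̂ₜ` is complex differentiable at every point of `ℍₒ`. [folklore] -/
theorem differentiableAt_fHat (hW : Continuous W) (t : ℝ≥0) {z : ℂ} (hz : 0 < z.im) :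
    DifferentiableAt ℂ (fHat W t) z := by
  obtain ⟨f', -, hd⟩ := hasDerivAt_fHat hW t hz
  exact hd.differentiableAt

/-- `f̂ₜ' ≠ 0` on `ℍₒ`. [folklore] -/
theorem deriv_fHat_ne_zero (hW : Continuous W) (t : ℝ≥0) {z : ℂ} (hz : 0 < z.im) :
    deriv (fHat W t) z ≠ 0 := by
  obtain ⟨f', hf', hd⟩ := hasDerivAt_fHat hW t hz
  rwa [hd.deriv]

/-- `f̂ₜ' (z) = fₜ' (z + W t)` (chain rule with a translation). [folklore] -/
theorem deriv_fHat (hW : Continuous W) (t : ℝ≥0) {z : ℂ} (hz : 0 < z.im) :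
    deriv (fHat W t) z = deriv (loewnerInv W t) ((W t : ℂ) + z) := by
  have hw : 0 < ((W t : ℂ) + z).im := by simpa using hz
  obtain ⟨f', -, hd⟩ := hasDerivAt_invFunOn_map hW t hw
  have htr : HasDerivAt (fun w : ℂ ↦ (W t : ℂ) + w) 1 z := (hasDerivAt_id z).const_add _
  have h := hd.comp z htr
  rw [mul_one] at h
  rw [hd.deriv]
  exact h.deriv

/-- Rohde–Schramm's **`H(y, t) := f̂ₜ(iy)`** (Thm. 3.6), as a function on `ℝ≥0 × ℝ≥0`
(first coordinate `y`, second `t`); junk at `y = 0`. [cite: RohdeSchramm2005, Thm 3.6] -/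
def tipApproach (W : ℝ≥0 → ℝ) (p : ℝ≥0 × ℝ≥0) : ℂ :=
  fHat W p.2 (I * (p.1 : ℝ))

/-- Unfolding lemma for `tipApproach`: `H(y, t) = gₜ⁻¹ (W t + iy)`, literally the expression in
`RohdeSchramm2005_thm36`. [folklore] -/
theorem tipApproach_apply (W : ℝ≥0 → ℝ) (y t : ℝ≥0) :
    tipApproach W (y, t) =
      Function.invFunOn (map W t) (domain W t) ((W t : ℂ) + I * (y : ℝ)) := rfl

/-- `H(y, t) ∈ Hₜ` for `y > 0`. [folklore] -/
theorem tipApproach_mem_domain (hW : Continuous W) {y : ℝ≥0} (hy : y ≠ 0) (t : ℝ≥0) :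
    tipApproach W (y, t) ∈ domain W t :=
  fHat_mem_domain hW t (by simpa using pos_iff_ne_zero.2 hy)

/-- `H(y, 0) = W 0 + iy` for `y > 0`. [folklore] -/
theorem tipApproach_zero_right (hW : Continuous W) {y : ℝ≥0} (hy : y ≠ 0) :
    tipApproach W (y, 0) = (W 0 : ℂ) + I * (y : ℝ) :=
  fHat_zero hW (by simpa using pos_iff_ne_zero.2 hy)

end Loewner

/-! ### The named fact -/

/-- **Rohde–Schramm (2005), Corollary 3.5** (derivative upper bounds at a fixed time; §3,
standing assumption `κ > 0`). Let `b ∈ [0, 1 + 4κ⁻¹]`, and define `λ` and `a` by (3.6) with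
`ν = 1` (`a = 2b + κb(1-b)/2`, `λ = 4b + κb(1-2b)/2`). There is a constant `C(κ, b)`, depending
only on `κ` and `b`, such that for all `t ∈ [0, 1]`, `y, δ ∈ (0, 1]` and `x ∈ ℝ`:
`P[|f̂ₜ'(x + iy)| ≥ δ y⁻¹] ≤ C(κ, b) (1 + x²/y²)ᵇ (y/δ)^λ ϑ(δ, a - λ)`, where `ϑ(δ, s)` is
`δ^{-s}`, `1 + |log δ|`, `1` according as `s > 0`, `s = 0`, `s < 0`. Here `ξ = √κ B` for a
Brownian motion `B` on `(Ω, P)` with continuous paths, `f̂ₜ(z) = fₜ(z + ξ(t))`, `fₜ = gₜ⁻¹`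
(`Loewner.fHat`), and `f̂ₜ'` is its complex derivative (`deriv`; `f̂ₜ` is holomorphic on `ℍₒ`,
`Loewner.hasDerivAt_fHat`). In Lean the constant is allowed to depend on the probability space
(it is chosen before `B`); the probabilities are outer measures, no measurability being asserted.
Printed proof: Lemma 3.1, Thm. 3.2 (Itô's formula for the time-changed backward flow) and the
Schwarz lemma, (3.17)–(3.18). [cite: RohdeSchramm2005, Cor 3.5] -/
def RohdeSchramm2005_cor35 {Ω : Type*} [MeasurableSpace Ω] (P : Measure Ω) : Prop :=
  ∀ (κ : ℝ≥0), κ ≠ 0 → ∀ b : ℝ, 0 ≤ b → b ≤ 1 + 4 / (κ : ℝ) →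
    ∃ C : ℝ, ∀ (B : ℝ≥0 → Ω → ℝ), IsBrownianReal B P → (∀ ω, Continuous (B · ω)) →
      ∀ (t : ℝ≥0), t ≤ 1 → ∀ (x y δ : ℝ), 0 < y → y ≤ 1 → 0 < δ → δ ≤ 1 →
        P {ω | δ / y ≤ ‖deriv (Loewner.fHat (fun s ↦ Real.sqrt κ * B s ω) t) (x + I * y)‖} ≤
          ENNReal.ofReal (C * (1 + x ^ 2 / y ^ 2) ^ b * (y / δ) ^ RohdeSchramm.expLam κ b *
            RohdeSchramm.theta δ (RohdeSchramm.expA κ b - RohdeSchramm.expLam κ b))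

/-- **Cor. 3.5 specialised as in the proof of Thm. 3.6** (p. 896, the display before (3.20), and
Lawler (2005), (7.12)): with `b = b⋆`, `x = 0`, `y = 2^{-j}`, `δ = 2^{-jσ}`, `0 < σ < σ₀`, the
probability that `|f̂ₜ'(i 2^{-j})| ≥ 2^{j} 2^{-jσ}` is `≤ C' (j + 1) 2^{-j(2 + ε)}` for some
`ε > 0` and all `t ≤ 1`, `j ∈ ℕ`. (Stated as a `Prop`-valued consequence; proved in
`RohdeSchramm2005_cor35.gridBound`.) [cite: RohdeSchramm2005, Thm 3.6 (proof, (3.20))] -/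
def RohdeSchramm2005_cor35.GridBound {Ω : Type*} [MeasurableSpace Ω] (P : Measure Ω) : Prop :=
  ∀ (κ : ℝ≥0), κ ≠ 0 → κ ≠ 8 → ∀ σ : ℝ, 0 < σ → σ < RohdeSchramm.sigma0 κ →
    ∃ ε : ℝ, 0 < ε ∧ ∃ C : ℝ, ∀ (B : ℝ≥0 → Ω → ℝ), IsBrownianReal B P →
      (∀ ω, Continuous (B · ω)) → ∀ (t : ℝ≥0), t ≤ 1 → ∀ j : ℕ,
        P {ω | (2 : ℝ) ^ ((1 - σ) * j) ≤
            ‖deriv (Loewner.fHat (fun s ↦ Real.sqrt κ * B s ω) t) (I * ((2 : ℝ) ^ (-(j : ℝ)) : ℝ))‖} ≤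
          ENNReal.ofReal (C * (j + 1) * (2 : ℝ) ^ (-(2 + ε) * j))

/-- **The grid bound follows from Cor. 3.5**: take `b = b⋆` (admissible, `bStar_mem_Icc`),
`x = 0`, `y = 2^{-j}`, `δ = 2^{-jσ}`; then `(y/δ)^λ ϑ(δ, a - λ) ≤ (1 + jσ log 2) 2^{-j e}` with
`e = (1 - σ)λ - σ max{a - λ, 0} > 2` (`two_lt_of_lt_sigma0`). This is the computation "By
Corollary 3.5, and because `σ < (λ - 2)/max{a, λ}`, this gives (3.20) for some `ε = ε(κ) > 0`"
of p. 896. [cite: RohdeSchramm2005, Thm 3.6 (proof, (3.20))] -/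
theorem RohdeSchramm2005_cor35.gridBound {Ω : Type*} [MeasurableSpace Ω] {P : Measure Ω}
    (h : RohdeSchramm2005_cor35 P) : RohdeSchramm2005_cor35.GridBound P := by
  intro κ hκ h8 σ hσ0 hσ
  have hκpos : (0 : ℝ) < κ := by exact_mod_cast pos_iff_ne_zero.2 hκ
  set A := RohdeSchramm.expA κ (RohdeSchramm.bStar κ) with hA
  set L := RohdeSchramm.expLam κ (RohdeSchramm.bStar κ) with hL
  set e := (1 - σ) * L - σ * max (A - L) 0 with he
  have he2 : 2 < e := RohdeSchramm.two_lt_of_lt_sigma0 hκpos hσ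
  have hσ1 : σ < 1 := hσ.trans (RohdeSchramm.sigma0_lt_one hκpos)
  obtain ⟨hb0, hb1⟩ := RohdeSchramm.bStar_mem_Icc hκpos
  obtain ⟨C, hC⟩ := h κ hκ (RohdeSchramm.bStar κ) hb0 hb1
  refine ⟨e - 2, by linarith, max C 0 * (1 + Real.log 2), fun B hB hBc t ht j ↦ ?_⟩
  have hj0 : (0 : ℝ) ≤ j := Nat.cast_nonneg j
  have hl2 : 0 ≤ Real.log 2 := Real.log_nonneg one_le_two
  -- the parameters `y = 2^{-j}`, `δ = 2^{-jσ}` of p. 896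
  obtain ⟨y, hy⟩ : ∃ y : ℝ, y = (2 : ℝ) ^ (-(j : ℝ)) := ⟨_, rfl⟩
  obtain ⟨δ, hδ⟩ : ∃ δ : ℝ, δ = (2 : ℝ) ^ (-(σ * j)) := ⟨_, rfl⟩
  have hy0 : 0 < y := hy ▸ Real.rpow_pos_of_pos two_pos _
  have hδ0 : 0 < δ := hδ ▸ Real.rpow_pos_of_pos two_pos _
  have hy1 : y ≤ 1 := hy ▸ Real.rpow_le_one_of_one_le_of_nonpos one_le_two (by linarith)
  have hσj : 0 ≤ σ * j := mul_nonneg hσ0.le hj0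
  have hδ1 : δ ≤ 1 := hδ ▸ Real.rpow_le_one_of_one_le_of_nonpos one_le_two (by linarith)
  have hdy : δ / y = (2 : ℝ) ^ ((1 - σ) * j) := by
    rw [hδ, hy, ← Real.rpow_sub two_pos]
    congr 1
    ring
  have hyd : y / δ = (2 : ℝ) ^ (-((1 - σ) * j)) := by
    rw [hδ, hy, ← Real.rpow_sub two_pos]
    congr 1
    ring
  have key := hC B hB hBc t ht 0 y δ hy0 hy1 hδ0 hδ1
  rw [← hL, ← hA] at key
  have hev : {ω | (2 : ℝ) ^ ((1 - σ) * j) ≤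
      ‖deriv (Loewner.fHat (fun s ↦ Real.sqrt κ * B s ω) t) (I * ((2 : ℝ) ^ (-(j : ℝ)) : ℝ))‖} =
      {ω | δ / y ≤ ‖deriv (Loewner.fHat (fun s ↦ Real.sqrt κ * B s ω) t) ((0 : ℝ) + I * y)‖} := by
    ext ω
    simp only [mem_setOf_eq]
    rw [hdy, Complex.ofReal_zero, zero_add, hy]
  rw [hev]
  refine key.trans (ENNReal.ofReal_le_ofReal ?_)
  -- the arithmetic of the right-hand side
  have hx : (1 + (0 : ℝ) ^ 2 / y ^ 2) ^ RohdeSchramm.bStar κ = 1 := by simp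
  rw [hx, mul_one]
  have hpow : (y / δ) ^ L = (2 : ℝ) ^ (-((1 - σ) * j) * L) := by
    rw [hyd, ← Real.rpow_mul two_pos.le]
  have hlogδ : |Real.log δ| = σ * j * Real.log 2 := by
    rw [hδ, Real.log_rpow two_pos]
    have h0 : 0 ≤ σ * j * Real.log 2 := mul_nonneg hσj hl2
    rw [abs_of_nonpos (by linarith)]
    ring
  have htheta : RohdeSchramm.theta δ (A - L) ≤
      (2 : ℝ) ^ (σ * j * max (A - L) 0) * (1 + |Real.log δ|) := by
    have h1 := RohdeSchramm.theta_le hδ0 hδ1 (A - L)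
    have h2 : δ ^ (-max (A - L) 0) = (2 : ℝ) ^ (σ * j * max (A - L) 0) := by
      rw [hδ, ← Real.rpow_mul two_pos.le]
      congr 1
      ring
    rwa [h2] at h1
  have hlogle : 1 + |Real.log δ| ≤ (j + 1) * (1 + Real.log 2) := by
    rw [hlogδ]
    have h1 : σ * (j * Real.log 2) ≤ j * Real.log 2 :=
      mul_le_of_le_one_left (mul_nonneg hj0 hl2) hσ1.le
    have h2 : σ * j * Real.log 2 = σ * (j * Real.log 2) := by ring
    rw [h2]
    nlinarith
  have hexp : (2 : ℝ) ^ (-((1 - σ) * j) * L) * (2 : ℝ) ^ (σ * j * max (A - L) 0) =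
      (2 : ℝ) ^ (-(2 + (e - 2)) * j) := by
    rw [← Real.rpow_add two_pos]
    congr 1
    rw [he]
    ring
  have hC0 : C ≤ max C 0 := le_max_left _ _
  have hm0 : 0 ≤ max C 0 := le_max_right _ _
  have hX : 0 ≤ (y / δ) ^ L := Real.rpow_nonneg (div_pos hy0 hδ0).le _
  have hT : 0 ≤ RohdeSchramm.theta δ (A - L) :=
    zero_le_one.trans (RohdeSchramm.one_le_theta hδ0 hδ1 _)
  calc C * (y / δ) ^ L * RohdeSchramm.theta δ (A - L)
      ≤ max C 0 * (y / δ) ^ L * RohdeSchramm.theta δ (A - L) :=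
        mul_le_mul_of_nonneg_right (mul_le_mul_of_nonneg_right hC0 hX) hT
    _ ≤ max C 0 * (y / δ) ^ L *
          ((2 : ℝ) ^ (σ * j * max (A - L) 0) * ((j + 1) * (1 + Real.log 2))) :=
        mul_le_mul_of_nonneg_left
          (htheta.trans (mul_le_mul_of_nonneg_left hlogle (Real.rpow_nonneg two_pos.le _)))
          (mul_nonneg hm0 hX)
    _ = max C 0 * (1 + Real.log 2) * (j + 1) * (2 : ℝ) ^ (-(2 + (e - 2)) * j) := by
        rw [hpow, ← hexp]
        ring

end Literature.Probability.RandomPlanarGeometry
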